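import Mathlib.Analysis.SpecialFunctions.SmoothTransition
import Mathlib.Analysis.Distribution.SchwartzSpace.Basic
import Mathlib.Analysis.InnerProductSpace.PiL2
import HarnessLib

/-!
# Smooth half-space cutoffs on multi-point Schwartz functions: the weights and the operators

Trunk **T-AQFT** (support file for the clustering / two-orbit synchronisation step of the
continuum limit on a trajectory), families `constructive-qft`, `yang-mills`.

On the `p`-point test function space `𝓢((Fin p → ℝᵈ), ℂ)` (`ℝᵈ = EuclideanSpace ℝ (Fin d)`, sup norm
over the points) this file DEFINES the smooth cutoffs to a half space in one coordinate `crd : Fin d`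
at a threshold `θ : ℝ`, built from Mathlib's smooth step `σ = Real.smoothTransition` (`σ = 0` on
`(-∞, 0]`, `σ = 1` on `[1, ∞)`):

* the coordinate functionals `coordCLM crd j x = xⱼ[crd]` (`|xⱼ[crd]| ≤ ‖x‖`, `abs_coord_le_norm`);
* the weights `wLE crd θ x = ∏ⱼ σ(θ + 1 - xⱼ[crd])` (`= 1` where all `xⱼ[crd] ≤ θ`, `wLE_eq_one`;
  `= 0` where some `xⱼ[crd] ≥ θ + 1`, `wLE_eq_zero`) and `wGE crd θ x = ∏ⱼ σ(xⱼ[crd] - θ + 1)`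
  (`= 1` where all `xⱼ[crd] ≥ θ`, `= 0` where some `xⱼ[crd] ≤ θ - 1`), with values in `[0, 1]`;
* the multiplication operators `cutLE crd θ`, `cutGE crd θ : 𝓢 →L[ℂ] 𝓢` by the complexified
  weights (`SchwartzMap.smulLeftCLM`).

Everything quantitative (smoothness, derivative bounds uniform in `θ`, `cutLE_apply`, supports,
uniform seminorm bounds, the polynomial tail bound `‖F - cutLE θ F‖_{k,l} ≤ C θ^{-N} sup ‖F‖_{k+N,·}`,
off-diagonality, commutation with translations) is in the companion files
`SchwartzHalfSpaceCutoffA/B/C`.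

## Sources

Textbook folklore: L. Hörmander, *The Analysis of Linear Partial Differential Operators I*, §7.1
(cutoffs and multipliers on `𝒮`); K. Osterwalder, R. Schrader, *Axioms for Euclidean Green's
functions*, CMP 31 (1973), §2 (the half-space test function spaces `𝒮(ℝ^{dn}_±)`).

## Mathlib

Used: `Real.smoothTransition` (`nonneg`, `le_one`, `zero_of_nonpos`, `one_of_one_le`),
`SchwartzMap.smulLeftCLM`, `EuclideanSpace.proj`, `ContinuousLinearMap.proj`, `PiLp.norm_apply_le`,
`norm_le_pi_norm`. Searched and absent at the pin: half-space / coordinate cutoffs on `SchwartzMap`.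
-/

set_option autoImplicit false

open scoped SchwartzMap ContDiff

noncomputable section

namespace Literature.MathematicalPhysics.QuantumLattice

/-! ### The half-space weights -/

section HalfSpace

variable {d p : ℕ}

/-- The coordinate functional `x ↦ xⱼ[crd]` on `(ℝᵈ)ᵖ` as a continuous linear map (Osterwalder–Schrader
1973 §2). [folklore] -/
def coordCLM (crd : Fin d) (j : Fin p) : (Fin p → EuclideanSpace ℝ (Fin d)) →L[ℝ] ℝ :=
  (EuclideanSpace.proj crd).comp (ContinuousLinearMap.proj j)

/-- `coordCLM crd j x = x j crd`. [folklore] -/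
@[simp]
theorem coordCLM_apply (crd : Fin d) (j : Fin p) (x : Fin p → EuclideanSpace ℝ (Fin d)) :
    coordCLM crd j x = x j crd := rfl

/-- A coordinate is bounded by the sup norm: `‖xⱼ[crd]‖ ≤ ‖x‖`. [folklore] -/
theorem norm_coord_le_norm (x : Fin p → EuclideanSpace ℝ (Fin d)) (j : Fin p) (crd : Fin d) :
    ‖x j crd‖ ≤ ‖x‖ :=
  (PiLp.norm_apply_le (x j) crd).trans (norm_le_pi_norm x j)

/-- A coordinate is bounded by the sup norm: `|xⱼ[crd]| ≤ ‖x‖`. [folklore] -/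
theorem abs_coord_le_norm (x : Fin p → EuclideanSpace ℝ (Fin d)) (j : Fin p) (crd : Fin d) :
    |x j crd| ≤ ‖x‖ := by
  rw [← Real.norm_eq_abs]
  exact norm_coord_le_norm x j crd

/-- `‖coordCLM crd j‖ ≤ 1`. [folklore] -/
theorem norm_coordCLM_le_one (crd : Fin d) (j : Fin p) : ‖coordCLM (p := p) crd j‖ ≤ 1 :=
  ContinuousLinearMap.opNorm_le_bound _ zero_le_one fun x => by
    rw [one_mul, coordCLM_apply]
    exact norm_coord_le_norm x j crd

/-- The coordinates are smooth. [folklore] -/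
theorem contDiff_coord (j : Fin p) (crd : Fin d) {m : WithTop ℕ∞} :
    ContDiff ℝ m fun x : Fin p → EuclideanSpace ℝ (Fin d) => x j crd :=
  (coordCLM crd j).contDiff

/-- **The lower half-space weight** `wLE crd θ x = ∏ⱼ σ(θ + 1 - xⱼ[crd])`, `σ = Real.smoothTransition`:
a smooth version of the indicator of `{x | ∀ j, xⱼ[crd] ≤ θ}` (equal to `1` there, vanishing where
some `xⱼ[crd] ≥ θ + 1`) (Osterwalder–Schrader 1973 §2; Hörmander, ALPDO I §7.1). [folklore] -/
def wLE (crd : Fin d) (θ : ℝ) (x : Fin p → EuclideanSpace ℝ (Fin d)) : ℝ :=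
  ∏ j, Real.smoothTransition (θ + 1 - x j crd)

/-- **The upper half-space weight** `wGE crd θ x = ∏ⱼ σ(xⱼ[crd] - θ + 1)`: a smooth version of the
indicator of `{x | ∀ j, θ ≤ xⱼ[crd]}` (equal to `1` there, vanishing where some `xⱼ[crd] ≤ θ - 1`)
(Osterwalder–Schrader 1973 §2; Hörmander, ALPDO I §7.1). [folklore] -/
def wGE (crd : Fin d) (θ : ℝ) (x : Fin p → EuclideanSpace ℝ (Fin d)) : ℝ :=
  ∏ j, Real.smoothTransition (x j crd - θ + 1)

variable (crd : Fin d) (θ : ℝ)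

/-- `0 ≤ wLE`. [folklore] -/
theorem wLE_nonneg (x : Fin p → EuclideanSpace ℝ (Fin d)) : 0 ≤ wLE crd θ x :=
  Finset.prod_nonneg fun _ _ => Real.smoothTransition.nonneg _

/-- `wLE ≤ 1`. [folklore] -/
theorem wLE_le_one (x : Fin p → EuclideanSpace ℝ (Fin d)) : wLE crd θ x ≤ 1 :=
  Finset.prod_le_one (fun _ _ => Real.smoothTransition.nonneg _) fun _ _ =>
    Real.smoothTransition.le_one _

/-- `0 ≤ wGE`. [folklore] -/
theorem wGE_nonneg (x : Fin p → EuclideanSpace ℝ (Fin d)) : 0 ≤ wGE crd θ x :=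
  Finset.prod_nonneg fun _ _ => Real.smoothTransition.nonneg _

/-- `wGE ≤ 1`. [folklore] -/
theorem wGE_le_one (x : Fin p → EuclideanSpace ℝ (Fin d)) : wGE crd θ x ≤ 1 :=
  Finset.prod_le_one (fun _ _ => Real.smoothTransition.nonneg _) fun _ _ =>
    Real.smoothTransition.le_one _

variable {crd θ}

/-- `wLE crd θ x = 1` when all `xⱼ[crd] ≤ θ`. [folklore] -/
theorem wLE_eq_one {x : Fin p → EuclideanSpace ℝ (Fin d)} (h : ∀ j, x j crd ≤ θ) :
    wLE crd θ x = 1 :=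
  Finset.prod_eq_one fun j _ => Real.smoothTransition.one_of_one_le (by linarith [h j])

/-- `wLE crd θ x = 0` when some `xⱼ[crd] ≥ θ + 1`. [folklore] -/
theorem wLE_eq_zero {x : Fin p → EuclideanSpace ℝ (Fin d)} {j : Fin p} (h : θ + 1 ≤ x j crd) :
    wLE crd θ x = 0 :=
  Finset.prod_eq_zero (Finset.mem_univ j) (Real.smoothTransition.zero_of_nonpos (by linarith))

/-- `wGE crd θ x = 1` when all `xⱼ[crd] ≥ θ`. [folklore] -/
theorem wGE_eq_one {x : Fin p → EuclideanSpace ℝ (Fin d)} (h : ∀ j, θ ≤ x j crd) :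
    wGE crd θ x = 1 :=
  Finset.prod_eq_one fun j _ => Real.smoothTransition.one_of_one_le (by linarith [h j])

/-- `wGE crd θ x = 0` when some `xⱼ[crd] ≤ θ - 1`. [folklore] -/
theorem wGE_eq_zero {x : Fin p → EuclideanSpace ℝ (Fin d)} {j : Fin p} (h : x j crd ≤ θ - 1) :
    wGE crd θ x = 0 :=
  Finset.prod_eq_zero (Finset.mem_univ j) (Real.smoothTransition.zero_of_nonpos (by linarith))

/-- On the open ball of radius `θ` the lower weight is `1` (all coordinates are `< θ`). [folklore] -/
theorem wLE_eq_one_of_norm_lt {x : Fin p → EuclideanSpace ℝ (Fin d)} (hx : ‖x‖ < θ) :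
    wLE crd θ x = 1 :=
  wLE_eq_one fun j => ((le_abs_self _).trans (abs_coord_le_norm x j crd)).trans hx.le

/-- On the open ball of radius `|θ|`, `θ < 0`, the upper weight is `1` (all coordinates are `> θ`).
[folklore] -/
theorem wGE_eq_one_of_norm_lt {x : Fin p → EuclideanSpace ℝ (Fin d)} (hx : ‖x‖ < |θ|) (hθ : θ < 0) :
    wGE crd θ x = 1 := by
  refine wGE_eq_one fun j => ?_
  rw [abs_of_neg hθ] at hx
  have h := (neg_abs_le _).trans' (neg_le_neg (abs_coord_le_norm x j crd))
  linarith


/-! ### The cutoff operators -/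

/-- **The lower half-space cutoff** `cutLE crd θ F = wLE crd θ · F` on `𝓢((ℝᵈ)ᵖ, ℂ)`: a continuous
linear map (multiplication by a function of temperate growth, `SchwartzMap.smulLeftCLM`)
(Osterwalder–Schrader 1973 §2; Hörmander, ALPDO I §7.1). [folklore] -/
def cutLE (crd : Fin d) (θ : ℝ) :
    𝓢((Fin p → EuclideanSpace ℝ (Fin d)), ℂ) →L[ℂ] 𝓢((Fin p → EuclideanSpace ℝ (Fin d)), ℂ) :=
  SchwartzMap.smulLeftCLM ℂ fun x => (wLE crd θ x : ℂ)

/-- **The upper half-space cutoff** `cutGE crd θ F = wGE crd θ · F` on `𝓢((ℝᵈ)ᵖ, ℂ)`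
(Osterwalder–Schrader 1973 §2; Hörmander, ALPDO I §7.1). [folklore] -/
def cutGE (crd : Fin d) (θ : ℝ) :
    𝓢((Fin p → EuclideanSpace ℝ (Fin d)), ℂ) →L[ℂ] 𝓢((Fin p → EuclideanSpace ℝ (Fin d)), ℂ) :=
  SchwartzMap.smulLeftCLM ℂ fun x => (wGE crd θ x : ℂ)

end HalfSpace

end Literature.MathematicalPhysics.QuantumLattice
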